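import Summits.Ventures.PercRepro.ThetaOmegaCoreThree

/-!
# The assembly: the core of (Ω) from two statements about two-edge points

Dossier proofs/MINE1-theoremS.md, Addendum 81 (mine-1, gen 42). In an all-exceptional family a
point that is not good is either a **bad edge** (one edge, `BadEdge`) or a **bad two-edge point**
(`BadTwo`: two edges, `Ω(K_q) < 2`, credit `< 2`) — `badEdge_or_badTwo_of_not_good`. Since three
bad edges are impossible (`three_bad_false`), the core statement `OmegaCore` follows from two
statements, both with 0 exceptions in the censuses of Addendum 81:

* `NoMixed` — a bad edge and a bad two-edge point never coexist;
* `NoThreeTwo` — three bad two-edge points are impossible;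

**`omegaCore_of_noMixed_noThreeTwo`**, hence `conjOmega_of_noMixed_noThreeTwo` and
`conjSigma_of_noMixed_noThreeTwo`: the kernel chain is
`ConjSigma ⟸ ConjOmega ⟸ OmegaCore ⟸ NoMixed ∧ NoThreeTwo`.
-/

namespace PercRepro.MSTight

open Finset

variable {α : Type*} [DecidableEq α]

section BadTwo

variable {q : α} {U : Finset α} {F : Finset (Finset α)} {c0 c1 : Finset α → Bool}

/-- **A bad two-edge point**: two edges whose edge family is exceptional and whose credit does not
pay them. -/
def BadTwo (U : Finset α) (F : Finset (Finset α)) (c0 c1 : Finset α → Bool) (q : α) : Prop :=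
  q ∈ U ∧ (qEdges q F).card = 2 ∧
    omegaCount (U.erase q) (qEdges q F) (edgeC0 q c0) c1 < 2 ∧ omegaCredit U F c0 c1 q < 2

/-- **Conjecture (NoMixed)**: a bad edge and a bad two-edge point never coexist. -/
def NoMixed (α : Type*) [DecidableEq α] : Prop :=
  ∀ (U : Finset α) (F : Finset (Finset α)) (c0 c1 : Finset α → Bool) (q r : α) (s : Finset α),
    BadEdge U F c0 c1 q s → BadTwo U F c0 c1 r → q ≠ r → False

/-- **Conjecture (NoThreeTwo)**: three bad two-edge points are impossible. -/
def NoThreeTwo (α : Type*) [DecidableEq α] : Prop :=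
  ∀ (U : Finset α) (F : Finset (Finset α)) (c0 c1 : Finset α → Bool) (q r p : α),
    BadTwo U F c0 c1 q → BadTwo U F c0 c1 r → BadTwo U F c0 c1 p → q ≠ r → q ≠ p → r ≠ p → False

/-- An exceptional edge family with one edge `{s}` has `c0 (s + q) ≠ c1 s`. -/
theorem exc_of_qEdges_eq_singleton {s : Finset α} (hK : qEdges q F = {s})
    (hexc : omegaCount (U.erase q) (qEdges q F) (edgeC0 q c0) c1 < (qEdges q F).card) :
    c0 (insert q s) ≠ c1 s := by
  intro h
  have hsK : s ∈ qEdges q F := by rw [hK]; exact mem_singleton_self s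
  have hmono : edgeC0 q c0 s = c1 s := h
  have := omegaCount_pos_of_mono (U := U.erase q) hsK hmono
  have hc : (qEdges q F).card = 1 := by rw [hK, card_singleton]
  rw [hc] at hexc
  omega

/-- **A point that is not good is a bad edge or a bad two-edge point** (in an all-exceptional
family). -/
theorem badEdge_or_badTwo_of_not_good (hq : q ∈ U) (hexc : ExcEdges U F c0 c1 q)
    (hbad : omegaCredit U F c0 c1 q < (qEdges q F).card) :
    (∃ s, BadEdge U F c0 c1 q s) ∨ BadTwo U F c0 c1 q := by
  obtain ⟨h1, h2, hlt⟩ := hexc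
  rcases Nat.lt_or_ge (qEdges q F).card 2 with hc | hc
  · -- one edge
    have hc1 : (qEdges q F).card = 1 := by omega
    obtain ⟨s, hK⟩ := card_eq_one.1 hc1
    have hsK : s ∈ qEdges q F := by rw [hK]; exact mem_singleton_self s
    obtain ⟨hsF, hqs, hsqF⟩ := mem_qEdges.1 hsK
    refine Or.inl ⟨s, hq, hsF, hqs, hsqF, exc_of_qEdges_eq_singleton hK hlt, ?_⟩
    rw [hc1] at hbad
    omega
  · have hc2 : (qEdges q F).card = 2 := by omega
    rw [hc2] at hlt hbad
    exact Or.inr ⟨hq, hc2, hlt, hbad⟩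

end BadTwo

section Assembly

/-- **The core statement follows from the two conjectures on two-edge points** together with
`three_bad_false`: if no point of a ground set with three points were good, three distinct points
would be bad; a bad edge among them excludes bad two-edge points, so all three would be bad edges
— impossible — and otherwise all three are bad two-edge points — impossible. -/
theorem omegaCore_of_noMixed_noThreeTwo (hM : NoMixed α) (hT : NoThreeTwo α) : OmegaCore α := by
  intro U F c0 c1 _ _ hU hexc
  by_contra hcon
  have hbad : ∀ q ∈ U, omegaCredit U F c0 c1 q < (qEdges q F).card := by
    intro q hq
    by_contra h
    exact hcon ⟨q, hq, by omega⟩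
  obtain ⟨q, r, p, hq, hr, hp, hqr, hqp, hrp⟩ := two_lt_card_iff.1 (by omega : 2 < U.card)
  have cq := badEdge_or_badTwo_of_not_good hq (hexc q hq) (hbad q hq)
  have cr := badEdge_or_badTwo_of_not_good hr (hexc r hr) (hbad r hr)
  have cp := badEdge_or_badTwo_of_not_good hp (hexc p hp) (hbad p hp)
  rcases cq with ⟨s, hs⟩ | hq2
  · rcases cr with ⟨t, ht⟩ | hr2
    · rcases cp with ⟨w, hw⟩ | hp2
      · exact three_bad_false hs ht hw hqr hqp hrp
      · exact hM U F c0 c1 q p s hs hp2 hqp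
    · exact hM U F c0 c1 q r s hs hr2 hqr
  · rcases cr with ⟨t, ht⟩ | hr2
    · exact hM U F c0 c1 r q t ht hq2 (Ne.symm hqr)
    · rcases cp with ⟨w, hw⟩ | hp2
      · exact hM U F c0 c1 p q w hw hq2 (Ne.symm hqp)
      · exact hT U F c0 c1 q r p hq2 hr2 hp2 hqr hqp hrp

/-- **(Ω) from the two conjectures on two-edge points.** -/
theorem conjOmega_of_noMixed_noThreeTwo (hM : NoMixed α) (hT : NoThreeTwo α) : ConjOmega α :=
  conjOmega_of_core (omegaCore_of_noMixed_noThreeTwo hM hT)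

/-- **(Σ) from the two conjectures on two-edge points.** -/
theorem conjSigma_of_noMixed_noThreeTwo [Fintype α] (hM : NoMixed α) (hT : NoThreeTwo α) :
    ConjSigma α :=
  conjSigma_of_conjOmega (conjOmega_of_noMixed_noThreeTwo hM hT)

end Assembly

end PercRepro.MSTight
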